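import Summits.BirchSwinnertonDyer.BirchSwinnertonDyer.Theorems.ClassRecordThreeEulerHalvesAtThreeCartanTorusCubeCutPSModPhi
import Summits.BirchSwinnertonDyer.BirchSwinnertonDyer.Theorems.ClassRecordThreeEulerHalvesAtThreeCartanTorusCubeCutCuspCharModThree
import Summits.BirchSwinnertonDyer.BirchSwinnertonDyer.Theorems.ManinLocalTwoThreeSL2OddPrimeSquareRoots
import Mathlib.Algebra.QuadraticDiscriminant
import HarnessLib

/-!
# Fixed points of `g ∈ GL₂(𝔽_q)` on `ℙ¹(𝔽_q)` by matrix type — the permutation character `π_{ℙ¹}` in the case split of `cubicNewvectorCharMat`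

Helper file `--supports stmt-BirchSwinnertonDyer-23422` (seat `bsd-stepL-tam3-p1` g23, LINE OWNER of crux 23422
`EulerHalvesAtThreeResidualUpperBound`, line `cartan` v11). It serves the registered stub (SUPPLY) `stub_cartanTorusLatticeSupply :
CartanCorrespondence.CartanTorusLatticeSupply` via the road `HOME/tam3-p1/g23/SUPPLY-ROAD-GG1.md` §1: the character `χ_W = cubicNewvectorChar q` of
the Cartan torus lattice is a combination of PERMUTATION CHARACTERS (`2χ_W = π_C − π_{ℙ¹}` at principal-series places, `χ_W = (π_pairs − π_{ℙ¹}) −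
½(π_{C₃} − π_Ω)` at cuspidal places); every one of them is computed from the number of fixed points of `g` on `ℙ¹(𝔽_q)`, which this file
determines in the SAME case split as `cubicNewvectorCharMat` (`Δ = tr² − 4 det`, `IsScalarMat`, `HasRatEigenvalue`), for odd `q`:
* §1 coordinates: `g • [t:1] = [t:1] ↔ g₁₀ t² + (g₁₁ − g₀₀) t − g₀₁ = 0` (`smul_fin_eq_fin_iff`), `g • ∞ = ∞ ↔ g₁₀ = 0`;
  `HasRatEigenvalue g ↔ IsSquare Δ` (`hasRatEigenvalue_iff_isSquare_discr`, `q` odd); `g • ∞ = ∞ ↔ g₁₀ = 0` is cartan-f2a∕tam3-p1's `PSMod.smul_inf_eq_inf_iff`;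
* §2 counting: `Nat.card {p // g • p = p} = [g₁₀ = 0] + #{t : g₁₀ t² + (g₁₁−g₀₀) t − g₀₁ = 0}` (`natCard_fixed_eq`) and the root counts of a quadratic ∕
  linear equation over `𝔽_q`;
* §3 **`natCard_fixed_P1`**: the number of fixed points is `q + 1` (scalar), `1` (`Δ = 0`, not scalar), `2` (`Δ ≠ 0` a square), `0` (`Δ` not a square);
  `natCard_fixed_P1_eq_rootCount`: = `rootCount g` (tam3-p1 g21, `…CuspCharModThree`) for non-scalar `g`.
HONEST FRAMING: elementary finite-field counting; nothing about SUPPLY, NUM, crux 23422 ∕ 19109 is proved here; BSD is proved for no curve. [folklore]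
-/

namespace Summit.BirchSwinnertonDyer.BirchSwinnertonDyer.Theorems.CartanSupply.FixedPoints

open Summit.BirchSwinnertonDyer.BirchSwinnertonDyer.Theorems.CartanDegree
open Summit.BirchSwinnertonDyer.BirchSwinnertonDyer.Theorems.CartanTorusCubeCut
open Summit.BirchSwinnertonDyer.BirchSwinnertonDyer.Theorems.CartanTorusCubeCut.Steinberg
open scoped LinearAlgebra.Projectivization

set_option linter.dupNamespace false
set_option autoImplicit false

noncomputable section

open scoped Classical

variable {q : ℕ} [Fact q.Prime]

/-! ## §1 Fixed points in coordinates -/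

/-- PROVED: `g • [t : 1] = [t : 1]` iff `t` is a root of `g₁₀ t² + (g₁₁ − g₀₀) t − g₀₁`. [folklore] -/
theorem smul_fin_eq_fin_iff (g : G q) (t : ZMod q) :
    g • (fin t : P1 q) = fin t ↔
      (g : Mat q) 1 0 * (t * t) + ((g : Mat q) 1 1 - (g : Mat q) 0 0) * t + (-(g : Mat q) 0 1) = 0 := by
  rw [fin, smul_mk_eq, Projectivization.mk_eq_mk_iff']
  constructor
  · rintro ⟨a, ha⟩
    have h0 := congrFun ha 0
    have h1 := congrFun ha 1
    simp [Matrix.mulVec, dotProduct, Fin.sum_univ_two] at h0 h1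
    -- h0 : a * t = g00 t + g01 ; h1 : a = g10 t + g11
    rw [h1] at h0
    linear_combination h0
  · intro h
    refine ⟨(g : Mat q) 1 0 * t + (g : Mat q) 1 1, ?_⟩
    ext i
    fin_cases i
    · simp [Matrix.mulVec, dotProduct, Fin.sum_univ_two]
      linear_combination h
    · simp [Matrix.mulVec, dotProduct, Fin.sum_univ_two]

/-- PROVED: `Δ = tr² − 4 det` in coordinates: the discriminant of the fixed-point quadratic `M₁₀ t² + (M₁₁ − M₀₀) t − M₀₁`. [folklore] -/
theorem discr_eq_discrim (M : Mat q) : M.trace ^ 2 - 4 * M.det = discrim (M 1 0) (M 1 1 - M 0 0) (-M 0 1) := by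
  rw [discrim, Matrix.trace_fin_two, Matrix.det_fin_two]
  ring

/-- PROVED: the characteristic equation `x² + det = tr·x` is the quadratic `1·x·x + (−tr)·x + det = 0`, whose discriminant is `Δ`.
[folklore] -/
theorem hasRatEigenvalue_iff_exists_quadratic (M : Mat q) :
    HasRatEigenvalue M ↔ ∃ x : ZMod q, 1 * (x * x) + (-M.trace) * x + M.det = 0 := by
  unfold HasRatEigenvalue
  constructor
  · rintro ⟨x, hx⟩; exact ⟨x, by linear_combination hx⟩
  · rintro ⟨x, hx⟩; exact ⟨x, by linear_combination hx⟩

/-- PROVED (`q` odd): `M` has an eigenvalue in `𝔽_q` iff `Δ = tr² − 4 det` is a square. [folklore] -/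
theorem hasRatEigenvalue_iff_isSquare_discr (h2 : (2 : ZMod q) ≠ 0) (M : Mat q) :
    HasRatEigenvalue M ↔ IsSquare (M.trace ^ 2 - 4 * M.det) := by
  haveI : NeZero (2 : ZMod q) := ⟨h2⟩
  have hdisc : discrim (1 : ZMod q) (-M.trace) M.det = M.trace ^ 2 - 4 * M.det := by rw [discrim]; ring
  rw [hasRatEigenvalue_iff_exists_quadratic]
  constructor
  · rintro ⟨x, hx⟩
    have := discrim_eq_sq_of_quadratic_eq_zero hx
    rw [hdisc] at this
    exact ⟨2 * 1 * x + -M.trace, by rw [this, sq]⟩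
  · rintro ⟨s, hs⟩
    exact exists_quadratic_eq_zero one_ne_zero ⟨s, by rw [hdisc, hs]⟩

/-! ## §2 Counting -/

/-- PROVED: the number of fixed points of `g` on `ℙ¹(𝔽_q)` is `[g₁₀ = 0] + #{t : g₁₀ t² + (g₁₁ − g₀₀) t − g₀₁ = 0}` (split `ℙ¹ = {∞} ⊔ 𝔸¹`).
[folklore] -/
theorem natCard_fixed_eq (g : G q) :
    Nat.card {p : P1 q // g • p = p} =
      (if (g : Mat q) 1 0 = 0 then 1 else 0) +
        (Finset.univ.filter fun t : ZMod q =>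
          (g : Mat q) 1 0 * (t * t) + ((g : Mat q) 1 1 - (g : Mat q) 0 0) * t + (-(g : Mat q) 0 1) = 0).card := by
  let P : Option (ZMod q) → Prop := fun o => g • (optEquiv o : P1 q) = optEquiv o
  have e : {p : P1 q // g • p = p} ≃ {o : Option (ZMod q) // P o} :=
    (optEquiv.symm.subtypeEquiv (fun p => by
      show g • p = p ↔ g • (optEquiv (optEquiv.symm p) : P1 q) = optEquiv (optEquiv.symm p)
      rw [Equiv.apply_symm_apply]))
  rw [Nat.card_congr e, Nat.card_eq_fintype_card, Fintype.card_subtype, Finset.card_filter, Fintype.sum_option]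
  congr 1
  · -- the point at infinity
    have : P none ↔ (g : Mat q) 1 0 = 0 := PSMod.smul_inf_eq_inf_iff g
    by_cases h : (g : Mat q) 1 0 = 0
    · rw [if_pos (this.mpr h), if_pos h]
    · rw [if_neg (fun hP => h (this.mp hP)), if_neg h]
  · rw [Finset.card_filter]
    refine Finset.sum_congr rfl (fun t _ => ?_)
    have : P (some t) ↔ (g : Mat q) 1 0 * (t * t) + ((g : Mat q) 1 1 - (g : Mat q) 0 0) * t + (-(g : Mat q) 0 1) = 0 :=
      smul_fin_eq_fin_iff g t
    by_cases h : (g : Mat q) 1 0 * (t * t) + ((g : Mat q) 1 1 - (g : Mat q) 0 0) * t + (-(g : Mat q) 0 1) = 0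
    · rw [if_pos (this.mpr h), if_pos h]
    · rw [if_neg (fun hP => h (this.mp hP)), if_neg h]

/-- PROVED: a quadratic `a t² + b t + c` (`a ≠ 0`, `q` odd) with non-square discriminant has no root in `𝔽_q`. [folklore] -/
theorem card_roots_quadratic_of_not_isSquare {a b c : ZMod q} (h : ¬ IsSquare (discrim a b c)) :
    (Finset.univ.filter fun t : ZMod q => a * (t * t) + b * t + c = 0).card = 0 := by
  rw [Finset.card_eq_zero, Finset.filter_eq_empty_iff]
  intro t _
  exact quadratic_ne_zero_of_discrim_ne_sq (fun s hs => h ⟨s, by rw [hs, sq]⟩) t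

/-- PROVED: a quadratic (`a ≠ 0`, `q` odd) with discriminant `0` has exactly one root. [folklore] -/
theorem card_roots_quadratic_of_discrim_eq_zero (h2 : (2 : ZMod q) ≠ 0) {a b c : ZMod q} (ha : a ≠ 0)
    (h : discrim a b c = 0) :
    (Finset.univ.filter fun t : ZMod q => a * (t * t) + b * t + c = 0).card = 1 := by
  haveI : NeZero (2 : ZMod q) := ⟨h2⟩
  rw [Finset.card_eq_one]
  refine ⟨-b / (2 * a), ?_⟩
  ext t
  rw [Finset.mem_filter, Finset.mem_singleton, quadratic_eq_zero_iff_of_discrim_eq_zero ha h]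
  simp

/-- PROVED: a quadratic (`a ≠ 0`, `q` odd) with non-zero square discriminant has exactly two roots. [folklore] -/
theorem card_roots_quadratic_of_isSquare (h2 : (2 : ZMod q) ≠ 0) {a b c : ZMod q} (ha : a ≠ 0)
    (h : IsSquare (discrim a b c)) (h0 : discrim a b c ≠ 0) :
    (Finset.univ.filter fun t : ZMod q => a * (t * t) + b * t + c = 0).card = 2 := by
  haveI : NeZero (2 : ZMod q) := ⟨h2⟩
  obtain ⟨s, hs⟩ := h
  have hs0 : s ≠ 0 := fun h' => h0 (by rw [hs, h', mul_zero])
  have h2a : (2 : ZMod q) * a ≠ 0 := mul_ne_zero h2 ha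
  rw [Finset.card_eq_two]
  refine ⟨(-b + s) / (2 * a), (-b - s) / (2 * a), ?_, ?_⟩
  · intro heq
    rw [div_eq_div_iff h2a h2a, mul_left_inj' h2a] at heq
    have h2s : (2 : ZMod q) * s = 0 := by linear_combination heq
    exact hs0 ((mul_eq_zero.mp h2s).resolve_left h2)
  · ext t
    rw [Finset.mem_filter, Finset.mem_insert, Finset.mem_singleton, quadratic_eq_zero_iff ha hs]
    simp

/-- PROVED: a linear equation `b t + c = 0` with `b ≠ 0` has exactly one root; with `b = 0` it has `q` roots if `c = 0` and none otherwise.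
[folklore] -/
theorem card_roots_linear (b c : ZMod q) :
    (Finset.univ.filter fun t : ZMod q => 0 * (t * t) + b * t + c = 0).card =
      if b ≠ 0 then 1 else if c = 0 then q else 0 := by
  by_cases hb : b ≠ 0
  · rw [if_pos hb, Finset.card_eq_one]
    refine ⟨-c / b, ?_⟩
    ext t
    rw [Finset.mem_filter, Finset.mem_singleton]
    simp only [Finset.mem_univ, true_and, zero_mul, zero_add]
    constructor
    · intro h; field_simp; linear_combination h
    · rintro rfl; field_simp; ring
  · rw [if_neg hb]
    push Not at hb
    subst hb
    by_cases hc : c = 0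
    · rw [if_pos hc, Finset.filter_true_of_mem (fun t _ => by simp [hc]), Finset.card_univ, ZMod.card]
    · rw [if_neg hc, Finset.card_eq_zero, Finset.filter_eq_empty_iff]
      intro t _
      simpa using hc

/-! ## §3 The count by matrix type -/

/-- PROVED: a scalar matrix fixes every point: `q + 1` fixed points. [folklore] -/
theorem natCard_fixed_of_isScalar (g : G q) (hs : IsScalarMat (g : Mat q)) :
    Nat.card {p : P1 q // g • p = p} = q + 1 := by
  obtain ⟨h01, h10, h00⟩ := hs
  rw [natCard_fixed_eq, if_pos h10, h10, h00, sub_self, h01, neg_zero, card_roots_linear, if_neg (by simp), if_pos rfl]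
  omega

/-- PROVED — **FIXED POINTS ON `ℙ¹(𝔽_q)` BY TYPE** (`q` odd): with `Δ = tr² − 4 det`, the number of fixed points of `g` is `q + 1` if `g` is scalar,
`1` if `Δ = 0` and `g` is not scalar, `2` if `Δ ≠ 0` and `g` has an eigenvalue in `𝔽_q`, and `0` if `g` has no eigenvalue in `𝔽_q` — the case split of
`cubicNewvectorCharMat`. [folklore] -/
theorem natCard_fixed_P1 (hq2 : q ≠ 2) (g : G q) :
    Nat.card {p : P1 q // g • p = p} =
      if IsScalarMat (g : Mat q) then q + 1
      else if (g : Mat q).trace ^ 2 - 4 * (g : Mat q).det = 0 then 1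
      else if HasRatEigenvalue (g : Mat q) then 2 else 0 := by
  haveI : NeZero (2 : ZMod q) := ManinLocalTwoThree.SL2ZModOddPrime.neZero_two hq2
  have h2 : (2 : ZMod q) ≠ 0 := NeZero.ne 2
  by_cases hs : IsScalarMat (g : Mat q)
  · rw [if_pos hs, natCard_fixed_of_isScalar g hs]
  rw [if_neg hs]
  set a := (g : Mat q) 1 0 with ha
  set b := (g : Mat q) 1 1 - (g : Mat q) 0 0 with hb
  set c := -(g : Mat q) 0 1 with hc
  have hΔ : (g : Mat q).trace ^ 2 - 4 * (g : Mat q).det = discrim a b c := discr_eq_discrim (g : Mat q)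
  have hsq : HasRatEigenvalue (g : Mat q) ↔ IsSquare (discrim a b c) := by
    rw [hasRatEigenvalue_iff_isSquare_discr h2, hΔ]
  rw [natCard_fixed_eq]
  by_cases ha0 : a = 0
  · -- upper triangular: `∞` is fixed; the finite fixed points solve `b t + c = 0`
    rw [if_pos ha0]
    have hlin : (Finset.univ.filter fun t : ZMod q => a * (t * t) + b * t + c = 0) =
        (Finset.univ.filter fun t : ZMod q => 0 * (t * t) + b * t + c = 0) := by rw [ha0]
    rw [hlin, card_roots_linear]
    have hdisc : discrim a b c = b ^ 2 := by rw [discrim, ha0]; ring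
    by_cases hb0 : b ≠ 0
    · -- two distinct eigenvalues on the diagonal
      have hΔ0 : (g : Mat q).trace ^ 2 - 4 * (g : Mat q).det ≠ 0 := by rw [hΔ, hdisc]; exact pow_ne_zero 2 hb0
      have hrat : HasRatEigenvalue (g : Mat q) := hsq.mpr ⟨b, by rw [hdisc, sq]⟩
      rw [if_pos hb0, if_neg hΔ0, if_pos hrat]
    · push Not at hb0
      -- `a = 0`, `b = 0`: not scalar forces `c ≠ 0`; then `Δ = 0` and exactly `∞` is fixed
      have hc0 : c ≠ 0 := by
        intro hc0
        apply hs
        refine ⟨?_, ha0, ?_⟩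
        · have : -(g : Mat q) 0 1 = 0 := hc0
          exact neg_eq_zero.mp this
        · exact (sub_eq_zero.mp hb0).symm
      have hΔ0 : (g : Mat q).trace ^ 2 - 4 * (g : Mat q).det = 0 := by rw [hΔ, hdisc, hb0]; ring
      rw [if_neg (not_not.mpr hb0), if_neg hc0, if_pos hΔ0]
  · -- `g₁₀ ≠ 0`: `∞` is not fixed; count the roots of the quadratic
    rw [if_neg ha0, zero_add]
    by_cases hΔ0 : (g : Mat q).trace ^ 2 - 4 * (g : Mat q).det = 0
    · rw [if_pos hΔ0]
      exact card_roots_quadratic_of_discrim_eq_zero h2 ha0 (by rw [← hΔ, hΔ0])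
    · rw [if_neg hΔ0]
      by_cases hrat : HasRatEigenvalue (g : Mat q)
      · rw [if_pos hrat]
        exact card_roots_quadratic_of_isSquare h2 ha0 (hsq.mp hrat) (by rw [← hΔ]; exact hΔ0)
      · rw [if_neg hrat]
        exact card_roots_quadratic_of_not_isSquare (fun h => hrat (hsq.mpr h))

/-- PROVED — the same in the currency of `CartanTorusCubeCut.rootCount` (number of rational eigenvalues, tam3-p1 g21): a NON-SCALAR `g` has
exactly `rootCount g` fixed points on `ℙ¹(𝔽_q)` (`q` odd), a scalar one has `q + 1`. [folklore] -/
theorem natCard_fixed_P1_eq_rootCount (hq2 : q ≠ 2) (g : G q) :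
    Nat.card {p : P1 q // g • p = p} = if IsScalarMat (g : Mat q) then q + 1 else rootCount (g : Mat q) := by
  haveI : NeZero (2 : ZMod q) := ManinLocalTwoThree.SL2ZModOddPrime.neZero_two hq2
  have h2 : (2 : ZMod q) ≠ 0 := NeZero.ne 2
  rw [natCard_fixed_P1 hq2]
  by_cases hs : IsScalarMat (g : Mat q)
  · rw [if_pos hs, if_pos hs]
  rw [if_neg hs, if_neg hs]
  by_cases hΔ0 : (g : Mat q).trace ^ 2 - 4 * (g : Mat q).det = 0
  · rw [if_pos hΔ0, rootCount_of_disc_eq_zero h2 hΔ0]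
  rw [if_neg hΔ0]
  by_cases hrat : HasRatEigenvalue (g : Mat q)
  · rw [if_pos hrat, rootCount_of_hasRatEigenvalue hΔ0 hrat]
  · rw [if_neg hrat, rootCount_of_not_hasRatEigenvalue hrat]

end

end Summit.BirchSwinnertonDyer.BirchSwinnertonDyer.Theorems.CartanSupply.FixedPoints
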